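import Summits.Ventures.QEC.Census.CertInfoSetOrbitStabFast
import Summits.Ventures.QEC.Census.CertCheckParityFast
import Summits.Ventures.QEC.Census.CertBZPlaneSound
import Summits.Ventures.QEC.Census.TwoBGA.S8_3x3x15_w6_k16_000001.Cert
import Summits.Ventures.QEC.Census.TwoBGA.S8_3x3x15_w6_k16_000001.Stab
import HarnessLib

/-!
# `S8_3x3x15_w6_k16_000001` — checks module `ChecksV` (est 57 s) of the KERNEL-std certificate of census row `S8_3x3x15_w6_k16_000001` (qec-search-4 g6 orbit-stabilized lane)

the STABILIZED views: RREF certificates (`infoSetStructOK`) and the fast structural checks `StabView.stabOKF` (`F ⊇ free`, base points, mask/orbit-mask invariance of the movers); assembled in `Census/TwoBGA/S8_3x3x15_w6_k16_000001/Distance.lean`.  Generated by `emit_stab_row.py`; do not edit by hand.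
-/

set_option autoImplicit false
set_option Elab.async false
set_option exponentiation.threshold 1024

namespace Summit.Ventures.QEC.Census.S8_3x3x15_w6_k16_000001

open Matrix Literature.InformationTheory.QuantumCodes Summit.Ventures.QEC.Census

/-- Stabilized view 0 of the `X` side is an RREF certificate of `H^Z`. -/
theorem viewX_0_ok : infoSetStructOK S8_3x3x15_w6_k16_000001.cert.n S8_3x3x15_w6_k16_000001.cert.HZ S8_3x3x15_w6_k16_000001.svX0.ic = true := by decide +kernel

/-- Stabilized view 0 of the `X` side passes the FAST structural check `stabOKF` (`F ⊇ free`; base points, `F`- and orbit-mask invariance of the movers). -/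
theorem stabX_0_ok : S8_3x3x15_w6_k16_000001.svX0.stabOKF S8_3x3x15_w6_k16_000001.cert.n (autPerms S8_3x3x15_w6_k16_000001.gensX) S8_3x3x15_w6_k16_000001.gensX.length = true := by decide +kernel

/-- Stabilized view 0 of the `Z` side is an RREF certificate of `H^X`. -/
theorem viewZ_0_ok : infoSetStructOK S8_3x3x15_w6_k16_000001.cert.n S8_3x3x15_w6_k16_000001.cert.HX S8_3x3x15_w6_k16_000001.svZ0.ic = true := by decide +kernel

/-- Stabilized view 0 of the `Z` side passes the FAST structural check `stabOKF` (`F ⊇ free`; base points, `F`- and orbit-mask invariance of the movers). -/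
theorem stabZ_0_ok : S8_3x3x15_w6_k16_000001.svZ0.stabOKF S8_3x3x15_w6_k16_000001.cert.n (autPerms S8_3x3x15_w6_k16_000001.gensZ) S8_3x3x15_w6_k16_000001.gensZ.length = true := by decide +kernel

end Summit.Ventures.QEC.Census.S8_3x3x15_w6_k16_000001
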